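import Summits.KontsevichZagierPeriods.KontsevichZagierPeriods.Theses.CobordismMove
import Literature.NumberTheory.Transcendental.KZLogCalculusProofs
import Literature.NumberTheory.Transcendental.KZUnfoldedStokesProofs
import Literature.NumberTheory.Transcendental.KZGroundingRelations

/-!
# `CubeStokes` (stmt-KontsevichZagierPeriods-5566, route CobordismMove) — complete proof

CLOSED-FORM STOKES ON THE UNIT CUBE IS A RELATION of the fixed Kontsevich–Zagier calculus of moves:
for `ℚ`-semialgebraic coefficients `A₀, …, A_d` continuous on `[0,1]^(d+1)` with partials
`A'_k = ∂_k A_k` on the open cube satisfying the closedness `Σ_k (−1)^k A'_k = 0`, the signed sum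
`Σ_k Σ_{s=0,1} (−1)^(k+s) [face_kˢ]` of the `2(d+1)` face representations lies in `KZ.relations`.

The proof is the typed decomposition of the strategist seat (2026-08-17) with ALL pieces proved:

* §1 `ZeroCombination` (item 17773, P3) — a `ℤ`-combination of representations on a common domain
  whose integrands combine to `0` pointwise is a relation (iterated rule (1b));
* §2 `CubeCoordinateCycle` (item 17772, P2) — cycling a coordinate to the last slot is ONE rule-(2)
  move for an arbitrary integrand (`|det| = 1` by volume preservation of the cube);
* §3 `CubeLastNewtonLeibniz` (item 17771, P1) — Newton–Leibniz along the last coordinate of the open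
  cube with bulk term: rule (1a) to the closed-fibre band (null faces), ONE rule-(3) move, rule (1b);
* §4 the assembly `cubeStokes_of_subs` (transport of `A_k`, `∂_k A_k` through the coordinate cycle,
  honest bulk representations, closedness, signs) and `cubeStokes_proof : CubeStokes`.

A prover lands this file verbatim as
`Summits/KontsevichZagierPeriods/KontsevichZagierPeriods/Theorems/CobordismMoveCubeStokes.lean`
(`ledger propose --target … --workitem stmt-KontsevichZagierPeriods-5566`; planners cannot write
Theorems, perm.theorems-prover-only); the three piece items close by `exact`-ing the §1–§3 theorems.

References: M. Kontsevich, D. Zagier, *Periods* (2001), §1.2, rules (1)–(3) ("in several variables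
one replaces the Newton–Leibniz formula by Stokes's formula"); A. Huber, S. Müller-Stach, *Periods and
Nori Motives* (2017), §13.1; J. Bochnak, M. Coste, M.-F. Roy, *Real Algebraic Geometry* (1998), §2.2.
-/

noncomputable section

open MeasureTheory Set MvPolynomial
open Literature.NumberTheory.Transcendental
open Literature.ModelTheory.ExponentialFields (IsSemialgebraic)

namespace Summit.KontsevichZagierPeriods.CobordismMove

open Summit.KontsevichZagierPeriods.KontsevichZagierPeriods.Theses.CobordismMove

/-! ## §1 `ZeroCombination` (P3) -/

namespace ZeroCombination

variable {n : ℕ}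

/-- An honest representation with a prescribed `ℚ`-semialgebraic, absolutely integrable integrand
on a `ℚ`-semialgebraic domain exists (it is the structure itself). [folklore] -/
theorem exists_rep {σ : Set (Fin n → ℝ)} (hσ : IsSemialgebraic ℚ σ) {g : (Fin n → ℝ) → ℝ}
    (hg : IsSemialgebraicFunOn ℚ σ g) (hint : IntegrableOn g σ) :
    ∃ s : KZ.IntegralRep n, s.domain = σ ∧ s.integrand = g :=
  ⟨⟨σ, g, hσ, hg, hint⟩, rfl, rfl⟩

/-- The integer multiple `[σ, c f]` of a representation `[σ, f]` exists as an honest representation.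
[cite: KontsevichZagier2001, §1.1] -/
theorem exists_zsmul_rep (r : KZ.IntegralRep n) (c : ℤ) :
    ∃ s : KZ.IntegralRep n, s.domain = r.domain ∧ s.integrand = fun x => (c : ℝ) * r.integrand x := by
  refine exists_rep r.isSemialgebraic_domain ?_ (r.integrableOn.const_mul (c : ℝ))
  have h := IsSemialgebraicFunOn.mul_holds (isSemialgebraicFunOn_ratCast r.isSemialgebraic_domain (c : ℚ))
    r.isSemialgebraicFunOn_integrand
  refine h.congr fun x _ => ?_
  simp

/-- **Integer multiples are derivable**: if `s = [σ, c f]` and `r = [σ, f]` then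
`[s] − c • [r] ∈ KZ.relations` (induction on `c`: integrand additivity upwards, integrand
additivity with `[σ, −f]` and `[σ, −f] + [σ, f] ∈ relations` downwards).
[cite: KontsevichZagier2001, §1.2 rule (1)] -/
theorem zsmul_sub_mem_relations (r : KZ.IntegralRep n) :
    ∀ (c : ℤ) (s : KZ.IntegralRep n), s.domain = r.domain →
      EqOn s.integrand (fun x => (c : ℝ) * r.integrand x) s.domain →
      KZ.of s - c • KZ.of r ∈ KZ.relations := by
  intro c
  induction c using Int.induction_on with
  | zero =>
    intro s hsd hsi
    rw [zero_smul, sub_zero]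
    exact KZ.of_mem_relations_of_eqOn_zero s fun x hx => by simpa using hsi hx
  | succ m ih =>
    intro s' hs'd hs'i
    obtain ⟨s, hsd, hsi⟩ := exists_zsmul_rep r (m : ℤ)
    have h1 : KZ.of s - (m : ℤ) • KZ.of r ∈ KZ.relations := ih s hsd (by rw [hsi]; exact fun x _ => rfl)
    have h2 : KZ.of s' - KZ.of s - KZ.of r ∈ KZ.relations := by
      refine KZ.integrandAddRel_subset_relations ⟨n, s', s, r, by rw [hsd, hs'd], hs'd.symm, ?_, rfl⟩
      intro x hx
      rw [hs'i hx, Pi.add_apply, hsi]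
      push_cast
      ring
    have : KZ.of s' - ((m : ℤ) + 1) • KZ.of r = (KZ.of s' - KZ.of s - KZ.of r) + (KZ.of s - (m : ℤ) • KZ.of r) := by
      rw [add_smul, one_smul]
      abel
    rw [this]
    exact KZ.relations.add_mem h2 h1
  | pred m ih =>
    intro s' hs'd hs'i
    obtain ⟨s, hsd, hsi⟩ := exists_zsmul_rep r (-(m : ℤ))
    have h1 : KZ.of s - (-(m : ℤ)) • KZ.of r ∈ KZ.relations := ih s hsd (by rw [hsi]; exact fun x _ => rfl)
    have h2 : KZ.of s' - KZ.of s - KZ.of r.neg ∈ KZ.relations := by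
      refine KZ.integrandAddRel_subset_relations ⟨n, s', s, r.neg, by rw [hsd, hs'd], ?_, ?_, rfl⟩
      · rw [KZ.IntegralRep.domain_neg, hs'd]
      · intro x hx
        rw [hs'i hx, Pi.add_apply, hsi, KZ.IntegralRep.integrand_neg, Pi.neg_apply]
        push_cast
        ring
    have h3 : KZ.of r.neg + KZ.of r ∈ KZ.relations := by
      have h := KZ.of_add_of_mem_relations_of_eqOn_neg (r := r) (r' := r.neg) (KZ.IntegralRep.domain_neg r)
        (fun x _ => by rw [KZ.IntegralRep.integrand_neg])
      rwa [add_comm] at h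
    have : KZ.of s' - (-(m : ℤ) - 1) • KZ.of r =
        (KZ.of s' - KZ.of s - KZ.of r.neg) + (KZ.of s - (-(m : ℤ)) • KZ.of r) + (KZ.of r.neg + KZ.of r) := by
      rw [sub_smul, one_smul]
      abel
    rw [this]
    exact KZ.relations.add_mem (KZ.relations.add_mem h2 h1) h3

/-- **`ZeroCombination`** (stmt-KontsevichZagierPeriods-17773): a `ℤ`-combination of integral
representations on a common domain `σ` whose integrands combine to `0` pointwise on `σ` lies in
`KZ.relations`. The statement is the literal body of the route item.
[cite: KontsevichZagier2001, §1.2 rule (1)] -/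
theorem zeroCombination_proof :
    ∀ (n N : ℕ) (σ : Set (Fin n → ℝ)) (R : Fin N → Literature.NumberTheory.Transcendental.KZ.IntegralRep n)
      (c : Fin N → ℤ), (∀ i, (R i).domain = σ) → (∀ x ∈ σ, ∑ i, (c i : ℝ) * (R i).integrand x = 0) →
      (∑ i, c i • Literature.NumberTheory.Transcendental.KZ.of (R i)) ∈
        Literature.NumberTheory.Transcendental.KZ.relations := by
  intro n N σ R c hdom hsum
  rcases Nat.eq_zero_or_pos N with rfl | hN
  · simp [KZ.relations.zero_mem]
  · have hσ : IsSemialgebraic ℚ σ := hdom ⟨0, hN⟩ ▸ (R ⟨0, hN⟩).isSemialgebraic_domain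
    -- the scaled representations `S i = [σ, cᵢ fᵢ]`
    choose S hSd hSi using fun i => exists_zsmul_rep (R i) (c i)
    have h1 : ∀ i, KZ.of (S i) - c i • KZ.of (R i) ∈ KZ.relations := fun i =>
      zsmul_sub_mem_relations (R i) (c i) (S i) (hSd i) (by rw [hSi i]; exact fun x _ => rfl)
    -- the honest representation `T = [σ, Σᵢ cᵢ fᵢ]`, whose integrand vanishes on `σ`
    have hTsa : IsSemialgebraicFunOn ℚ σ (fun x => ∑ i, (S i).integrand x) :=
      KZ.isSemialgebraicFunOn_finset_sum Finset.univ hσ fun i _ => by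
        rw [← hdom i, ← hSd i]
        exact (S i).isSemialgebraicFunOn_integrand
    have hTint : IntegrableOn (fun x => ∑ i, (S i).integrand x) σ :=
      integrable_finsetSum Finset.univ fun i _ => by
        have h := (S i).integrableOn
        rwa [hSd i, hdom i] at h
    obtain ⟨T, hTd, hTi⟩ := exists_rep hσ hTsa hTint
    have h2 : KZ.of T - ∑ i, KZ.of (S i) ∈ KZ.relations :=
      KZ.of_sub_sum_integrand_mem_relations Finset.univ S T (fun i _ => by rw [hSd i, hdom i, hTd])
        (by rw [hTi]; exact fun x _ => rfl)
    have h3 : KZ.of T ∈ KZ.relations := by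
      refine KZ.of_mem_relations_of_eqOn_zero T fun x hx => ?_
      rw [hTd] at hx
      simp only [hTi, hSi, Pi.zero_apply]
      exact hsum x hx
    have key : ∑ i, c i • KZ.of (R i) =
        KZ.of T - (KZ.of T - ∑ i, KZ.of (S i)) - ∑ i, (KZ.of (S i) - c i • KZ.of (R i)) := by
      rw [Finset.sum_sub_distrib]
      abel
    rw [key]
    exact KZ.relations.sub_mem (KZ.relations.sub_mem h3 h2) (KZ.relations.sum_mem fun i _ => h1 i)

end ZeroCombination

/-! ## §2 `CubeCoordinateCycle` (P2) -/

namespace CubeCoordinateCycle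

variable {d : ℕ}

/-- The coordinate cycle `z ↦ Fin.insertNth k (z last) (Fin.init z)` of `ℝ^(d+1)` is the
relabelling of coordinates along the index permutation
`(finSuccEquiv' k).trans (finSuccEquiv' (Fin.last d)).symm` (`k ↦ last`, `k.succAbove j ↦ j.castSucc`).
[folklore] -/
theorem exists_perm_insertNth (k : Fin (d + 1)) :
    ∃ e : Equiv.Perm (Fin (d + 1)), ∀ z : Fin (d + 1) → ℝ,
      (fun i => z (e i)) = (Fin.insertNth k (z (Fin.last d)) (Fin.init z) : Fin (d + 1) → ℝ) := by
  refine ⟨(finSuccEquiv' k).trans (finSuccEquiv' (Fin.last d)).symm, fun z => ?_⟩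
  funext i
  rcases Fin.eq_self_or_eq_succAbove k i with rfl | ⟨j, rfl⟩
  · simp [finSuccEquiv'_at, finSuccEquiv'_symm_none, Fin.insertNth_apply_same]
  · simp [finSuccEquiv'_succAbove, finSuccEquiv'_symm_some, Fin.insertNth_apply_succAbove,
      Fin.succAbove_last, Fin.init]

/-- The open unit cube is invariant under relabelling coordinates. [folklore] -/
theorem comp_perm_mem_setOf_iff {n : ℕ} (e : Equiv.Perm (Fin n)) (z : Fin n → ℝ) :
    (fun i => z (e i)) ∈ {x : Fin n → ℝ | ∀ i, x i ∈ Ioo (0 : ℝ) 1} ↔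
      z ∈ {x : Fin n → ℝ | ∀ i, x i ∈ Ioo (0 : ℝ) 1} := by
  simp only [mem_setOf_eq]
  exact ⟨fun h i => by simpa using h (e.symm i), fun h i => h (e i)⟩

/-- The open unit cube has Lebesgue measure `1`. [folklore] -/
theorem volume_setOf_cube (n : ℕ) :
    volume {x : Fin n → ℝ | ∀ i, x i ∈ Ioo (0 : ℝ) 1} = 1 := by
  rw [show {x : Fin n → ℝ | ∀ i, x i ∈ Ioo (0 : ℝ) 1} = Set.pi univ fun _ => Ioo (0 : ℝ) 1 from
    KZ.unitCube_eq_pi n, Real.volume_pi_Ioo]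
  simp

/-- **`CubeCoordinateCycle`** (stmt-KontsevichZagierPeriods-17772): cycling a coordinate of the open
unit cube to the last slot is a move, for an arbitrary integrand. The statement is the literal body
of the route item. [cite: KontsevichZagier2001, §1.2 rule (2)] -/
theorem cubeCoordinateCycle_proof :
    ∀ (d : ℕ) (k : Fin (d + 1)) (R R' : Literature.NumberTheory.Transcendental.KZ.IntegralRep (d + 1)),
      R.domain = {x : Fin (d + 1) → ℝ | ∀ i, x i ∈ Set.Ioo (0 : ℝ) 1} →
      R'.domain = {x : Fin (d + 1) → ℝ | ∀ i, x i ∈ Set.Ioo (0 : ℝ) 1} →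
      Set.EqOn R'.integrand (fun z => R.integrand (Fin.insertNth k (z (Fin.last d)) (Fin.init z))) R'.domain →
      Literature.NumberTheory.Transcendental.KZ.of R - Literature.NumberTheory.Transcendental.KZ.of R' ∈
        Literature.NumberTheory.Transcendental.KZ.relations := by
  intro d k R R' hRd hR'd hR'i
  obtain ⟨e, he⟩ := exists_perm_insertNth (d := d) k
  -- the relabelling as a continuous linear map
  set L : (Fin (d + 1) → ℝ) →L[ℝ] (Fin (d + 1) → ℝ) :=
    LinearMap.toContinuousLinearMap (LinearMap.funLeft ℝ ℝ e) with hL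
  have hLapply : ∀ x : Fin (d + 1) → ℝ, L x = fun i => x (e i) := fun x => by
    rw [hL, LinearMap.coe_toContinuousLinearMap']
    rfl
  -- `L` maps the cube onto itself, injectively
  have himage : L '' R'.domain = R.domain := by
    rw [hRd, hR'd]
    ext y
    constructor
    · rintro ⟨x, hx, rfl⟩
      rw [hLapply]
      exact (comp_perm_mem_setOf_iff e x).2 hx
    · intro hy
      refine ⟨fun i => y (e.symm i), ?_, ?_⟩
      · have h := (comp_perm_mem_setOf_iff e.symm y).2 hy
        exact h
      · rw [hLapply]
        funext i
        simp
  have hLinj : InjOn L R'.domain := by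
    intro x _ y _ hxy
    rw [hLapply, hLapply] at hxy
    funext j
    have h := congr_fun hxy (e.symm j)
    simpa using h
  -- `L` is a `ℚ`-polynomial (coordinate) map, hence semialgebraic
  have hLsa : IsSemialgebraicMapOn ℚ R'.domain L := by
    refine (isSemialgebraicMapOn_aeval R'.isSemialgebraic_domain fun j => X (e j)).congr fun x _ => ?_
    rw [hLapply]
    ext j
    simp
  -- `|det L| = 1` by volume preservation of the cube
  have hdet : |L.det| = 1 := by
    have h := Measure.addHaar_image_continuousLinearMap volume L R'.domain
    rw [himage, hRd, volume_setOf_cube, hR'd, volume_setOf_cube, mul_one] at h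
    exact ENNReal.ofReal_eq_one.1 h.symm
  -- one change-of-variables move from `R'` to `R`
  have hcov : KZ.of R' - KZ.of R ∈ KZ.changeOfVariablesRel := by
    refine ⟨d + 1, R', R, L, fun _ => L, hLsa, fun _ _ => L.hasFDerivWithinAt, hLinj, himage.symm,
      fun x hx => ?_, rfl⟩
    rw [hR'i hx, hdet, mul_one, hLapply, he x]
  have h := KZ.changeOfVariablesRel_subset_relations hcov
  have hneg : KZ.of R - KZ.of R' = -(KZ.of R' - KZ.of R) := by abel
  rw [hneg]
  exact KZ.relations.neg_mem h

end CubeCoordinateCycle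

/-! ## §3 `CubeLastNewtonLeibniz` (P1) -/

namespace CubeLastNewtonLeibniz

variable {d : ℕ}

/-! ### The open cubes, the band and its faces -/

/-- `t ↦ Fin.snoc x t` is continuous. [folklore] -/
theorem continuous_snoc (x : Fin d → ℝ) :
    Continuous (fun t : ℝ => (Fin.snoc x t : Fin (d + 1) → ℝ)) := by
  refine continuous_pi fun i => ?_
  refine Fin.lastCases ?_ (fun j => ?_) i
  · simp only [Fin.snoc_last]
    exact continuous_id
  · simp only [Fin.snoc_castSucc]
    exact continuous_const

/-- A point of the open `d`-cube with a last coordinate in `(0,1)` is a point of the open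
`(d+1)`-cube. [folklore] -/
theorem snoc_mem_setOf {x : Fin d → ℝ} (hx : x ∈ {y : Fin d → ℝ | ∀ i, y i ∈ Ioo (0 : ℝ) 1})
    {t : ℝ} (ht : t ∈ Ioo (0 : ℝ) 1) :
    (Fin.snoc x t : Fin (d + 1) → ℝ) ∈ {z : Fin (d + 1) → ℝ | ∀ i, z i ∈ Ioo (0 : ℝ) 1} := by
  simp only [mem_setOf_eq] at hx ⊢
  intro i
  refine Fin.lastCases ?_ (fun j => ?_) i
  · simpa [Fin.snoc_last] using ht
  · simpa [Fin.snoc_castSucc] using hx j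

/-- A point of the open `d`-cube with a last coordinate in `[0,1]` is a point of the closed
`(d+1)`-cube. [folklore] -/
theorem snoc_mem_Icc {x : Fin d → ℝ} (hx : x ∈ {y : Fin d → ℝ | ∀ i, y i ∈ Ioo (0 : ℝ) 1})
    {t : ℝ} (ht : t ∈ Icc (0 : ℝ) 1) :
    (Fin.snoc x t : Fin (d + 1) → ℝ) ∈ Icc (0 : Fin (d + 1) → ℝ) 1 := by
  simp only [mem_setOf_eq] at hx
  rw [mem_Icc, Pi.le_def, Pi.le_def]
  constructor
  · intro i
    refine Fin.lastCases ?_ (fun j => ?_) i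
    · simpa [Fin.snoc_last] using ht.1
    · simpa [Fin.snoc_castSucc] using (hx j).1.le
  · intro i
    refine Fin.lastCases ?_ (fun j => ?_) i
    · simpa [Fin.snoc_last] using ht.2
    · simpa [Fin.snoc_castSucc] using (hx j).2.le

/-- The open `(d+1)`-cube lies in the closed-fibre band over the open `d`-cube. [folklore] -/
theorem setOf_subset_band :
    {z : Fin (d + 1) → ℝ | ∀ i, z i ∈ Ioo (0 : ℝ) 1} ⊆
      KZlog.band {y : Fin d → ℝ | ∀ i, y i ∈ Ioo (0 : ℝ) 1} (fun _ => 0) (fun _ => 1) := by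
  intro z hz
  simp only [mem_setOf_eq] at hz
  refine ⟨fun j => hz (Fin.castSucc j), (hz (Fin.last d)).1.le, (hz (Fin.last d)).2.le⟩

/-- The closed-fibre band over the open `d`-cube lies in the closed `(d+1)`-cube. [folklore] -/
theorem band_subset_Icc :
    KZlog.band {y : Fin d → ℝ | ∀ i, y i ∈ Ioo (0 : ℝ) 1} (fun _ => 0) (fun _ => 1) ⊆
      Icc (0 : Fin (d + 1) → ℝ) 1 := by
  intro z hz
  rw [KZlog.mem_band, mem_setOf_eq] at hz
  obtain ⟨hinit, h0, h1⟩ := hz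
  rw [mem_Icc, Pi.le_def, Pi.le_def]
  constructor
  · intro i
    refine Fin.lastCases ?_ (fun j => ?_) i
    · simpa using h0
    · simpa [Fin.init] using (hinit j).1.le
  · intro i
    refine Fin.lastCases ?_ (fun j => ?_) i
    · simpa using h1
    · simpa [Fin.init] using (hinit j).2.le

/-- The band minus the open cube lies in the two faces `{z last = 0} ∪ {z last = 1}`.
[folklore] -/
theorem band_diff_subset :
    KZlog.band {y : Fin d → ℝ | ∀ i, y i ∈ Ioo (0 : ℝ) 1} (fun _ => 0) (fun _ => 1) \
        {z : Fin (d + 1) → ℝ | ∀ i, z i ∈ Ioo (0 : ℝ) 1} ⊆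
      {z : Fin (d + 1) → ℝ | z (Fin.last d) = 0} ∪ {z : Fin (d + 1) → ℝ | z (Fin.last d) = 1} := by
  rintro z ⟨hzB, hzU⟩
  rw [KZlog.mem_band, mem_setOf_eq] at hzB
  obtain ⟨hinit, h0, h1⟩ := hzB
  simp only [mem_setOf_eq, not_forall] at hzU
  obtain ⟨i, hi⟩ := hzU
  simp only [mem_union, mem_setOf_eq]
  by_contra hcon
  push Not at hcon
  apply hi
  refine Fin.lastCases ?_ (fun j => ?_) i
  · exact ⟨lt_of_le_of_ne h0 (Ne.symm hcon.1), lt_of_le_of_ne h1 hcon.2⟩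
  · exact hinit j

/-! ### The proof -/

/-- **`CubeLastNewtonLeibniz`** (stmt-KontsevichZagierPeriods-17771): Newton–Leibniz along the last
coordinate of the open unit cube, bulk term included — `[R] − [r₁] + [r₀] ∈ KZ.relations`. The
statement is the literal body of the route item. [cite: KontsevichZagier2001, §1.2 rule (3)] -/
theorem cubeLastNewtonLeibniz_proof :
    ∀ (d : ℕ) (A A' : (Fin (d + 1) → ℝ) → ℝ) (R : Literature.NumberTheory.Transcendental.KZ.IntegralRep (d + 1))
      (r₀ r₁ : Literature.NumberTheory.Transcendental.KZ.IntegralRep d),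
      Literature.NumberTheory.Transcendental.IsSemialgebraicFunOn ℚ (Set.Icc (0 : Fin (d + 1) → ℝ) 1) A →
      ContinuousOn A (Set.Icc (0 : Fin (d + 1) → ℝ) 1) →
      (∀ y ∈ {y : Fin d → ℝ | ∀ i, y i ∈ Set.Ioo (0 : ℝ) 1}, ∀ t ∈ Set.Ioo (0 : ℝ) 1,
        HasDerivAt (fun s : ℝ => A (Fin.snoc y s)) (A' (Fin.snoc y t)) t) →
      R.domain = {x : Fin (d + 1) → ℝ | ∀ i, x i ∈ Set.Ioo (0 : ℝ) 1} →
      Set.EqOn R.integrand A' R.domain →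
      r₀.domain = {y : Fin d → ℝ | ∀ i, y i ∈ Set.Ioo (0 : ℝ) 1} →
      r₁.domain = {y : Fin d → ℝ | ∀ i, y i ∈ Set.Ioo (0 : ℝ) 1} →
      Set.EqOn r₀.integrand (fun y => A (Fin.snoc y 0)) r₀.domain →
      Set.EqOn r₁.integrand (fun y => A (Fin.snoc y 1)) r₁.domain →
      Literature.NumberTheory.Transcendental.KZ.of R - Literature.NumberTheory.Transcendental.KZ.of r₁ +
        Literature.NumberTheory.Transcendental.KZ.of r₀ ∈ Literature.NumberTheory.Transcendental.KZ.relations := by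
  intro d A A' R r₀ r₁ hA hcont hder hRd hRi hr₀d hr₁d hface₀ hface₁
  -- the cubes and the band
  have hUd : IsSemialgebraic ℚ {y : Fin d → ℝ | ∀ i, y i ∈ Ioo (0 : ℝ) 1} := KZ.isSemialgebraic_unitCube d
  have hU : IsSemialgebraic ℚ {x : Fin (d + 1) → ℝ | ∀ i, x i ∈ Ioo (0 : ℝ) 1} :=
    KZ.isSemialgebraic_unitCube (d + 1)
  have hUdm : MeasurableSet {y : Fin d → ℝ | ∀ i, y i ∈ Ioo (0 : ℝ) 1} :=
    (KZ.isOpen_unitCube d).measurableSet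
  have hUm : MeasurableSet R.domain := KZ.IntegralRep.measurableSet_domain_holds R
  have hB : IsSemialgebraic ℚ
      (KZlog.band {y : Fin d → ℝ | ∀ i, y i ∈ Ioo (0 : ℝ) 1} (fun _ => 0) (fun _ => 1)) :=
    KZlog.isSemialgebraic_band (by simpa using isSemialgebraicFunOn_ratCast hUd 0)
      (by simpa using isSemialgebraicFunOn_ratCast hUd 1)
  have hT : IsSemialgebraic ℚ
      (KZlog.band {y : Fin d → ℝ | ∀ i, y i ∈ Ioo (0 : ℝ) 1} (fun _ => 0) (fun _ => 1) \ R.domain) := by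
    rw [Set.sdiff_eq]
    exact hB.inter (hRd ▸ hU).compl
  have hUB : R.domain ⊆ KZlog.band {y : Fin d → ℝ | ∀ i, y i ∈ Ioo (0 : ℝ) 1} (fun _ => 0) (fun _ => 1) := by
    rw [hRd]
    exact setOf_subset_band
  -- (1a) the integrand of `R` extended by zero, an honest representation on the band
  have hgsa : IsSemialgebraicFunOn ℚ
      (KZlog.band {y : Fin d → ℝ | ∀ i, y i ∈ Ioo (0 : ℝ) 1} (fun _ => 0) (fun _ => 1))
      (R.domain.indicator R.integrand) := by
    have h := IsSemialgebraicFunOn.union R.isSemialgebraicFunOn_integrand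
      (isSemialgebraicFunOn_ratCast hT 0) (F := R.domain.indicator R.integrand)
      (fun x hx => Set.indicator_of_mem hx _) (fun x hx => by
        rw [Set.indicator_of_notMem hx.2]
        simp)
    rwa [Set.union_sdiff_cancel hUB] at h
  have hgint : IntegrableOn (R.domain.indicator R.integrand)
      (KZlog.band {y : Fin d → ℝ | ∀ i, y i ∈ Ioo (0 : ℝ) 1} (fun _ => 0) (fun _ => 1)) :=
    ((integrable_indicator_iff hUm).2 R.integrableOn).integrableOn
  have hRbex : ∃ Rb : KZ.IntegralRep (d + 1),
      Rb.domain = KZlog.band {y : Fin d → ℝ | ∀ i, y i ∈ Ioo (0 : ℝ) 1} (fun _ => 0) (fun _ => 1) ∧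
        Rb.integrand = R.domain.indicator R.integrand :=
    ⟨⟨_, _, hB, hgsa, hgint⟩, rfl, rfl⟩
  obtain ⟨Rb, hRbd, hRbi⟩ := hRbex
  have hNtex : ∃ Nt : KZ.IntegralRep (d + 1),
      Nt.domain = KZlog.band {y : Fin d → ℝ | ∀ i, y i ∈ Ioo (0 : ℝ) 1} (fun _ => 0) (fun _ => 1) \ R.domain ∧
        Nt.integrand = R.domain.indicator R.integrand :=
    ⟨⟨_, _, hT, hgsa.mono Set.sdiff_subset hT, hgint.mono_set Set.sdiff_subset⟩, rfl, rfl⟩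
  obtain ⟨Nt, hNtd, hNti⟩ := hNtex
  have h1a : KZ.of Rb - KZ.of R - KZ.of Nt ∈ KZ.relations := by
    refine KZ.domainAddRel_subset_relations ⟨d + 1, Rb, R, Nt, ?_, ?_, ?_, ?_, rfl⟩
    · rw [hRbd, hNtd, Set.union_sdiff_cancel hUB]
    · rw [hNtd, Set.inter_sdiff_self, measure_empty]
    · intro x hx
      rw [hRbi, Set.indicator_of_mem hx]
    · intro x _
      rw [hRbi, hNti]
  have hNt : KZ.of Nt ∈ KZ.relations := by
    refine KZ.of_mem_relations_of_volume_eq_zero Nt ?_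
    rw [hNtd]
    refine measure_mono_null ?_
      (measure_union_null (KZ.volume_setOf_last_eq_zero (n := d) 0) (KZ.volume_setOf_last_eq_zero (n := d) 1))
    rw [hRd]
    exact band_diff_subset
  -- (3) the base representation `[(0,1)^d, A(·,1) − A(·,0)]` and the Newton–Leibniz instance
  have hA1sa : IsSemialgebraicFunOn ℚ {y : Fin d → ℝ | ∀ i, y i ∈ Ioo (0 : ℝ) 1}
      (fun y => A (Fin.snoc y 1)) := by
    have h := r₁.isSemialgebraicFunOn_integrand
    rw [hr₁d] at h
    exact h.congr fun y hy => hface₁ (by rw [hr₁d]; exact hy)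
  have hA0sa : IsSemialgebraicFunOn ℚ {y : Fin d → ℝ | ∀ i, y i ∈ Ioo (0 : ℝ) 1}
      (fun y => A (Fin.snoc y 0)) := by
    have h := r₀.isSemialgebraicFunOn_integrand
    rw [hr₀d] at h
    exact h.congr fun y hy => hface₀ (by rw [hr₀d]; exact hy)
  have hDsa : IsSemialgebraicFunOn ℚ {y : Fin d → ℝ | ∀ i, y i ∈ Ioo (0 : ℝ) 1}
      (fun y => A (Fin.snoc y 1) - A (Fin.snoc y 0)) :=
    (IsSemialgebraicFunOn.sub_holds hA1sa hA0sa).congr fun _ _ => rfl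
  have hA1int : IntegrableOn (fun y => A (Fin.snoc y 1)) {y : Fin d → ℝ | ∀ i, y i ∈ Ioo (0 : ℝ) 1} := by
    have h := r₁.integrableOn
    rw [hr₁d] at h
    exact h.congr_fun (fun y hy => hface₁ (by rw [hr₁d]; exact hy)) hUdm
  have hA0int : IntegrableOn (fun y => A (Fin.snoc y 0)) {y : Fin d → ℝ | ∀ i, y i ∈ Ioo (0 : ℝ) 1} := by
    have h := r₀.integrableOn
    rw [hr₀d] at h
    exact h.congr_fun (fun y hy => hface₀ (by rw [hr₀d]; exact hy)) hUdm
  have hrDex : ∃ rD : KZ.IntegralRep d, rD.domain = {y : Fin d → ℝ | ∀ i, y i ∈ Ioo (0 : ℝ) 1} ∧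
      rD.integrand = fun y => A (Fin.snoc y 1) - A (Fin.snoc y 0) :=
    ⟨⟨_, _, hUd, hDsa, hA1int.sub hA0int⟩, rfl, rfl⟩
  obtain ⟨rD, hrDd, hrDi⟩ := hrDex
  have h3 : KZ.of Rb - KZ.of rD ∈ KZ.relations := by
    refine KZ.newtonLeibnizRel_subset_relations ⟨d, Rb, rD, fun _ => 0, fun _ => 1, A, ?_, ?_, ?_,
      fun _ _ => zero_le_one, ?_, ?_, ?_, ?_, rfl⟩
    · rw [hRbd]
      exact hA.mono band_subset_Icc hB
    · simpa using isSemialgebraicFunOn_ratCast rD.isSemialgebraic_domain 0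
    · simpa using isSemialgebraicFunOn_ratCast rD.isSemialgebraic_domain 1
    · rw [hRbd, hrDd]
      rfl
    · intro x hx
      rw [hrDd] at hx
      exact hcont.comp (continuous_snoc x).continuousOn fun t ht => snoc_mem_Icc hx ht
    · intro x hx t ht
      rw [hrDd] at hx
      have hmem : (Fin.snoc x t : Fin (d + 1) → ℝ) ∈ R.domain := by
        rw [hRd]
        exact snoc_mem_setOf hx ht
      refine (hder x hx t ht).congr_deriv ?_
      rw [hRbi, Set.indicator_of_mem hmem]
      exact (hRi hmem).symm
    · intro x _
      rw [hrDi]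
  -- (1b) split the base representation into the two faces
  have h1b : KZ.of rD - KZ.of r₁ - KZ.of r₀.neg ∈ KZ.relations := by
    refine KZ.integrandAddRel_subset_relations ⟨d, rD, r₁, r₀.neg, by rw [hr₁d, hrDd],
      by rw [KZ.IntegralRep.domain_neg, hr₀d, hrDd], fun y hy => ?_, rfl⟩
    rw [hrDd] at hy
    rw [hrDi, Pi.add_apply, KZ.IntegralRep.integrand_neg, Pi.neg_apply,
      hface₁ (by rw [hr₁d]; exact hy), hface₀ (by rw [hr₀d]; exact hy)]
    ring
  have hneg : KZ.of r₀.neg + KZ.of r₀ ∈ KZ.relations := by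
    have h := KZ.of_add_of_mem_relations_of_eqOn_neg (r := r₀) (r' := r₀.neg)
      (KZ.IntegralRep.domain_neg r₀) (fun x _ => by rw [KZ.IntegralRep.integrand_neg])
    rwa [add_comm] at h
  -- collect
  have key : KZ.of R - KZ.of r₁ + KZ.of r₀ =
      -(KZ.of Rb - KZ.of R - KZ.of Nt) - KZ.of Nt + (KZ.of Rb - KZ.of rD) +
        (KZ.of rD - KZ.of r₁ - KZ.of r₀.neg) + (KZ.of r₀.neg + KZ.of r₀) := by
    abel
  rw [key]
  exact KZ.relations.add_mem (KZ.relations.add_mem (KZ.relations.add_mem (KZ.relations.sub_mem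
    (KZ.relations.neg_mem h1a) hNt) h3) h1b) hneg

end CubeLastNewtonLeibniz

/-! ## §4 The assembly -/

namespace CubeStokesSplit


variable {d : ℕ}

/-! ### Coordinate cycles as index permutations -/

/-- The coordinate cycle `z ↦ Fin.insertNth k (z last) (Fin.init z)` of `ℝ^(d+1)` is the
relabelling of coordinates along an index permutation (namely
`(finSuccEquiv' k).trans (finSuccEquiv' (Fin.last d)).symm`: `k ↦ last`, `k.succAbove j ↦ j.castSucc`).
[folklore] -/
theorem exists_perm_insertNth (k : Fin (d + 1)) :
    ∃ e : Equiv.Perm (Fin (d + 1)), ∀ z : Fin (d + 1) → ℝ,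
      (fun i => z (e i)) = (Fin.insertNth k (z (Fin.last d)) (Fin.init z) : Fin (d + 1) → ℝ) := by
  refine ⟨(finSuccEquiv' k).trans (finSuccEquiv' (Fin.last d)).symm, fun z => ?_⟩
  funext i
  rcases Fin.eq_self_or_eq_succAbove k i with rfl | ⟨j, rfl⟩
  · simp [finSuccEquiv'_at, finSuccEquiv'_symm_none, Fin.insertNth_apply_same]
  · simp [finSuccEquiv'_succAbove, finSuccEquiv'_symm_some, Fin.insertNth_apply_succAbove,
      Fin.succAbove_last, Fin.init]

/-- The open unit cube is invariant under relabelling coordinates. [folklore] -/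
theorem comp_perm_mem_setOf_iff {n : ℕ} (e : Equiv.Perm (Fin n)) (z : Fin n → ℝ) :
    (fun i => z (e i)) ∈ {x : Fin n → ℝ | ∀ i, x i ∈ Ioo (0 : ℝ) 1} ↔
      z ∈ {x : Fin n → ℝ | ∀ i, x i ∈ Ioo (0 : ℝ) 1} := by
  simp only [mem_setOf_eq]
  exact ⟨fun h i => by simpa using h (e.symm i), fun h i => h (e i)⟩

/-- The closed unit cube is invariant under relabelling coordinates. [folklore] -/
theorem comp_perm_mem_Icc_iff {n : ℕ} (e : Equiv.Perm (Fin n)) (z : Fin n → ℝ) :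
    (fun i => z (e i)) ∈ Icc (0 : Fin n → ℝ) 1 ↔ z ∈ Icc (0 : Fin n → ℝ) 1 := by
  simp only [mem_Icc, Pi.le_def, Pi.zero_apply, Pi.one_apply]
  constructor
  · rintro ⟨h0, h1⟩
    exact ⟨fun i => by simpa using h0 (e.symm i), fun i => by simpa using h1 (e.symm i)⟩
  · rintro ⟨h0, h1⟩
    exact ⟨fun i => h0 (e i), fun i => h1 (e i)⟩

/-- Semialgebraicity on the open unit cube is invariant under relabelling coordinates.
[cite: BCR1998, §2.2] -/
theorem isSemialgebraicFunOn_comp_perm_setOf {n : ℕ} (e : Equiv.Perm (Fin n))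
    {f : (Fin n → ℝ) → ℝ} (hf : IsSemialgebraicFunOn ℚ {x : Fin n → ℝ | ∀ i, x i ∈ Ioo (0 : ℝ) 1} f) :
    IsSemialgebraicFunOn ℚ {x : Fin n → ℝ | ∀ i, x i ∈ Ioo (0 : ℝ) 1}
      (fun z => f (fun i => z (e i))) := by
  have h := hf.comp_equiv e
  have hset : {w : Fin n → ℝ | (fun i => w (e i)) ∈ {x : Fin n → ℝ | ∀ i, x i ∈ Ioo (0 : ℝ) 1}} =
      {x : Fin n → ℝ | ∀ i, x i ∈ Ioo (0 : ℝ) 1} := by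
    ext w
    exact comp_perm_mem_setOf_iff e w
  rwa [hset] at h

/-- Semialgebraicity on the closed unit cube is invariant under relabelling coordinates.
[cite: BCR1998, §2.2] -/
theorem isSemialgebraicFunOn_comp_perm_Icc {n : ℕ} (e : Equiv.Perm (Fin n))
    {f : (Fin n → ℝ) → ℝ} (hf : IsSemialgebraicFunOn ℚ (Icc (0 : Fin n → ℝ) 1) f) :
    IsSemialgebraicFunOn ℚ (Icc (0 : Fin n → ℝ) 1) (fun z => f (fun i => z (e i))) := by
  have h := hf.comp_equiv e
  have hset : {w : Fin n → ℝ | (fun i => w (e i)) ∈ Icc (0 : Fin n → ℝ) 1} =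
      Icc (0 : Fin n → ℝ) 1 := by
    ext w
    exact comp_perm_mem_Icc_iff e w
  rwa [hset] at h

/-- Relabelling coordinates is continuous. [folklore] -/
theorem continuous_comp_perm {n : ℕ} (e : Equiv.Perm (Fin n)) :
    Continuous (fun z : Fin n → ℝ => fun i => z (e i)) :=
  continuous_pi fun i => continuous_apply (e i)

/-- Absolute integrability on the open unit cube is invariant under relabelling coordinates: the
relabelling is the volume-preserving `MeasurableEquiv.piCongrLeft` and preserves the cube.
[folklore] -/
theorem integrableOn_comp_perm_setOf {n : ℕ} (e : Equiv.Perm (Fin n)) {f : (Fin n → ℝ) → ℝ}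
    (hf : IntegrableOn f {x : Fin n → ℝ | ∀ i, x i ∈ Ioo (0 : ℝ) 1}) :
    IntegrableOn (fun z => f (fun i => z (e i))) {x : Fin n → ℝ | ∀ i, x i ∈ Ioo (0 : ℝ) 1} := by
  set L : (Fin n → ℝ) ≃ᵐ (Fin n → ℝ) := MeasurableEquiv.piCongrLeft (fun _ : Fin n => ℝ) e.symm
    with hL_def
  have hL : MeasurePreserving L volume volume :=
    volume_measurePreserving_piCongrLeft (fun _ : Fin n => ℝ) e.symm
  have hLapply : ∀ z : Fin n → ℝ, L z = fun i => z (e i) := by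
    intro z
    funext i
    have h := Equiv.piCongrLeft_apply_apply (fun _ : Fin n => ℝ) e.symm z (e i)
    rw [hL_def, MeasurableEquiv.coe_piCongrLeft]
    simpa using h
  have hpre : L ⁻¹' {x : Fin n → ℝ | ∀ i, x i ∈ Ioo (0 : ℝ) 1} =
      {x : Fin n → ℝ | ∀ i, x i ∈ Ioo (0 : ℝ) 1} := by
    ext z
    rw [mem_preimage, hLapply]
    exact comp_perm_mem_setOf_iff e z
  have h := (hL.integrableOn_comp_preimage L.measurableEmbedding (f := f)
    (s := {x : Fin n → ℝ | ∀ i, x i ∈ Ioo (0 : ℝ) 1})).mpr hf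
  rw [hpre] at h
  exact h.congr_fun (fun z _ => by simp only [Function.comp_apply, hLapply])
    (KZ.isOpen_unitCube n).measurableSet

/-- Updating the inserted coordinate. [folklore] -/
theorem update_insertNth (k : Fin (d + 1)) (t s : ℝ) (y : Fin d → ℝ) :
    Function.update (Fin.insertNth k t y : Fin (d + 1) → ℝ) k s = Fin.insertNth k s y := by
  rw [KZ.insertNth_eq_update k t y, KZ.insertNth_eq_update k s y, Function.update_idem]

/-- Inserting a coordinate in `(0,1)` into a point of the open `d`-cube gives a point of the open
`(d+1)`-cube. [folklore] -/
theorem insertNth_mem_setOf (k : Fin (d + 1)) {t : ℝ} (ht : t ∈ Ioo (0 : ℝ) 1) {y : Fin d → ℝ}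
    (hy : y ∈ {y : Fin d → ℝ | ∀ i, y i ∈ Ioo (0 : ℝ) 1}) :
    (Fin.insertNth k t y : Fin (d + 1) → ℝ) ∈ {x : Fin (d + 1) → ℝ | ∀ i, x i ∈ Ioo (0 : ℝ) 1} := by
  simp only [mem_setOf_eq] at hy ⊢
  intro i
  rcases Fin.eq_self_or_eq_succAbove k i with rfl | ⟨j, rfl⟩
  · simpa [Fin.insertNth_apply_same] using ht
  · simpa [Fin.insertNth_apply_succAbove] using hy j

/-! ### The assembly -/

/-- **`CubeStokes` from its three pieces** (glue of the split
`CubeLastNewtonLeibniz → CubeCoordinateCycle → ZeroCombination → CubeStokes` of route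
CobordismMove; the three hypotheses are the literal bodies of the three children).
For each coordinate `k` the coefficient `A_k` and its partial `A'_k` are transported through the
coordinate cycle `z ↦ insertNth k (z last) (init z)` (semialgebraicity, continuity, integrability,
fibrewise derivative), the bulk representation `R_k = [(0,1)^(d+1), A'_k]` and its cycled copy
`R̃_k` are built; (P2) gives `[R_k] − [R̃_k] ∈ relations`, (P1) gives
`[R̃_k] − [face_k¹] + [face_k⁰] ∈ relations`, (P3) with the closedness
`Σ_k (−1)^k A'_k = 0` gives `Σ_k (−1)^k [R_k] ∈ relations`, and
`Σ_k Σ_s (−1)^(k+s) [face_kˢ] = Σ_k (−1)^k (([R̃_k] − [face_k¹] + [face_k⁰]) + ([R_k] − [R̃_k])) − Σ_k (−1)^k [R_k]`.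
[cite: KontsevichZagier2001, §1.2] -/
theorem cubeStokes_of_subs
    (h₁ : ∀ (d : ℕ) (A A' : (Fin (d + 1) → ℝ) → ℝ)
      (R : Literature.NumberTheory.Transcendental.KZ.IntegralRep (d + 1))
      (r₀ r₁ : Literature.NumberTheory.Transcendental.KZ.IntegralRep d),
      Literature.NumberTheory.Transcendental.IsSemialgebraicFunOn ℚ (Set.Icc (0 : Fin (d + 1) → ℝ) 1) A →
      ContinuousOn A (Set.Icc (0 : Fin (d + 1) → ℝ) 1) →
      (∀ y ∈ {y : Fin d → ℝ | ∀ i, y i ∈ Set.Ioo (0 : ℝ) 1}, ∀ t ∈ Set.Ioo (0 : ℝ) 1,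
        HasDerivAt (fun s : ℝ => A (Fin.snoc y s)) (A' (Fin.snoc y t)) t) →
      R.domain = {x : Fin (d + 1) → ℝ | ∀ i, x i ∈ Set.Ioo (0 : ℝ) 1} →
      Set.EqOn R.integrand A' R.domain →
      r₀.domain = {y : Fin d → ℝ | ∀ i, y i ∈ Set.Ioo (0 : ℝ) 1} →
      r₁.domain = {y : Fin d → ℝ | ∀ i, y i ∈ Set.Ioo (0 : ℝ) 1} →
      Set.EqOn r₀.integrand (fun y => A (Fin.snoc y 0)) r₀.domain →
      Set.EqOn r₁.integrand (fun y => A (Fin.snoc y 1)) r₁.domain →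
      Literature.NumberTheory.Transcendental.KZ.of R - Literature.NumberTheory.Transcendental.KZ.of r₁ +
        Literature.NumberTheory.Transcendental.KZ.of r₀ ∈ Literature.NumberTheory.Transcendental.KZ.relations)
    (h₂ : ∀ (d : ℕ) (k : Fin (d + 1)) (R R' : Literature.NumberTheory.Transcendental.KZ.IntegralRep (d + 1)),
      R.domain = {x : Fin (d + 1) → ℝ | ∀ i, x i ∈ Set.Ioo (0 : ℝ) 1} →
      R'.domain = {x : Fin (d + 1) → ℝ | ∀ i, x i ∈ Set.Ioo (0 : ℝ) 1} →
      Set.EqOn R'.integrand (fun z => R.integrand (Fin.insertNth k (z (Fin.last d)) (Fin.init z))) R'.domain →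
      Literature.NumberTheory.Transcendental.KZ.of R - Literature.NumberTheory.Transcendental.KZ.of R' ∈
        Literature.NumberTheory.Transcendental.KZ.relations)
    (h₃ : ∀ (n N : ℕ) (σ : Set (Fin n → ℝ)) (R : Fin N → Literature.NumberTheory.Transcendental.KZ.IntegralRep n)
      (c : Fin N → ℤ), (∀ i, (R i).domain = σ) → (∀ x ∈ σ, ∑ i, (c i : ℝ) * (R i).integrand x = 0) →
      (∑ i, c i • Literature.NumberTheory.Transcendental.KZ.of (R i)) ∈
        Literature.NumberTheory.Transcendental.KZ.relations) :
    CubeStokes := by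
  intro d A A' rf hA hA' hcont hder hint hclosed hdom hface
  -- index permutations realising the coordinate cycles `z ↦ insertNth k (z last) (init z)`
  choose e he using fun k : Fin (d + 1) => exists_perm_insertNth (d := d) k
  -- (a) transport of the coefficient data through the cycles
  have hBsa : ∀ k : Fin (d + 1), IsSemialgebraicFunOn ℚ (Icc (0 : Fin (d + 1) → ℝ) 1)
      (fun z => A k (Fin.insertNth k (z (Fin.last d)) (Fin.init z))) := fun k =>
    (isSemialgebraicFunOn_comp_perm_Icc (e k) (hA k)).congr fun z _ => congrArg (A k) (he k z)
  have hB'sa : ∀ k : Fin (d + 1), IsSemialgebraicFunOn ℚ {x : Fin (d + 1) → ℝ | ∀ i, x i ∈ Ioo (0 : ℝ) 1}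
      (fun z => A' k (Fin.insertNth k (z (Fin.last d)) (Fin.init z))) := fun k =>
    (isSemialgebraicFunOn_comp_perm_setOf (e k) (hA' k)).congr fun z _ => congrArg (A' k) (he k z)
  have hB'int : ∀ k : Fin (d + 1),
      IntegrableOn (fun z => A' k (Fin.insertNth k (z (Fin.last d)) (Fin.init z)))
        {x : Fin (d + 1) → ℝ | ∀ i, x i ∈ Ioo (0 : ℝ) 1} := fun k =>
    (integrableOn_comp_perm_setOf (e k) (hint k)).congr_fun (fun z _ => congrArg (A' k) (he k z))
      (KZ.isOpen_unitCube (d + 1)).measurableSet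
  have hBcont : ∀ k : Fin (d + 1),
      ContinuousOn (fun z => A k (Fin.insertNth k (z (Fin.last d)) (Fin.init z)))
        (Icc (0 : Fin (d + 1) → ℝ) 1) := by
    intro k
    have h : ContinuousOn (fun z : Fin (d + 1) → ℝ => A k (fun i => z (e k i)))
        (Icc (0 : Fin (d + 1) → ℝ) 1) :=
      (hcont k).comp (continuous_comp_perm (e k)).continuousOn fun z hz =>
        (comp_perm_mem_Icc_iff (e k) z).2 hz
    exact h.congr fun z _ => (congrArg (A k) (he k z)).symm
  have hBder : ∀ k : Fin (d + 1), ∀ y ∈ {y : Fin d → ℝ | ∀ i, y i ∈ Ioo (0 : ℝ) 1},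
      ∀ t ∈ Ioo (0 : ℝ) 1,
      HasDerivAt
        (fun s : ℝ => A k (Fin.insertNth k ((Fin.snoc y s : Fin (d + 1) → ℝ) (Fin.last d))
          (Fin.init (Fin.snoc y s : Fin (d + 1) → ℝ))))
        (A' k (Fin.insertNth k ((Fin.snoc y t : Fin (d + 1) → ℝ) (Fin.last d))
          (Fin.init (Fin.snoc y t : Fin (d + 1) → ℝ)))) t := by
    intro k y hy t ht
    simp only [Fin.snoc_last, Fin.init_snoc]
    have hx : (Fin.insertNth k t y : Fin (d + 1) → ℝ) ∈
        {x : Fin (d + 1) → ℝ | ∀ i, x i ∈ Ioo (0 : ℝ) 1} := insertNth_mem_setOf k ht hy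
    have h := hder k _ hx
    simp only [Fin.insertNth_apply_same, update_insertNth] at h
    exact h
  -- (b) the bulk representations `R k = [(0,1)^(d+1), A' k]` and their cycled copies `Rt k`
  have hUsa : IsSemialgebraic ℚ {x : Fin (d + 1) → ℝ | ∀ i, x i ∈ Ioo (0 : ℝ) 1} :=
    KZ.isSemialgebraic_unitCube (d + 1)
  have hRex : ∀ k : Fin (d + 1), ∃ Rk : KZ.IntegralRep (d + 1),
      Rk.domain = {x : Fin (d + 1) → ℝ | ∀ i, x i ∈ Ioo (0 : ℝ) 1} ∧ Rk.integrand = A' k := fun k =>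
    ⟨⟨{x | ∀ i, x i ∈ Ioo (0 : ℝ) 1}, A' k, hUsa, hA' k, hint k⟩, rfl, rfl⟩
  choose R hRd hRi using hRex
  have hRtex : ∀ k : Fin (d + 1), ∃ Rk : KZ.IntegralRep (d + 1),
      Rk.domain = {x : Fin (d + 1) → ℝ | ∀ i, x i ∈ Ioo (0 : ℝ) 1} ∧
        Rk.integrand = fun z => A' k (Fin.insertNth k (z (Fin.last d)) (Fin.init z)) := fun k =>
    ⟨⟨{x | ∀ i, x i ∈ Ioo (0 : ℝ) 1}, fun z => A' k (Fin.insertNth k (z (Fin.last d)) (Fin.init z)),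
      hUsa, hB'sa k, hB'int k⟩, rfl, rfl⟩
  choose Rt hRtd hRti using hRtex
  -- (c) the three pieces
  have h2 : ∀ k : Fin (d + 1), KZ.of (R k) - KZ.of (Rt k) ∈ KZ.relations := fun k =>
    h₂ d k (R k) (Rt k) (hRd k) (hRtd k) fun z _ => by rw [hRti k, hRi k]
  have h1 : ∀ k : Fin (d + 1), KZ.of (Rt k) - KZ.of (rf k 1) + KZ.of (rf k 0) ∈ KZ.relations := by
    intro k
    refine h₁ d (fun z => A k (Fin.insertNth k (z (Fin.last d)) (Fin.init z)))
      (fun z => A' k (Fin.insertNth k (z (Fin.last d)) (Fin.init z))) (Rt k) (rf k 0) (rf k 1)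
      (hBsa k) (hBcont k) (hBder k) (hRtd k) (fun z _ => by rw [hRti k]) (hdom k 0) (hdom k 1)
      ?_ ?_
    · intro y hy
      rw [hface k 0 hy]
      simp
    · intro y hy
      rw [hface k 1 hy]
      simp
  have h3 : (∑ k : Fin (d + 1), ((-1 : ℤ) ^ (k : ℕ)) • KZ.of (R k)) ∈ KZ.relations := by
    refine h₃ (d + 1) (d + 1) {x : Fin (d + 1) → ℝ | ∀ i, x i ∈ Ioo (0 : ℝ) 1} R
      (fun k => (-1 : ℤ) ^ (k : ℕ)) (fun k => hRd k) fun x hx => ?_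
    have h := hclosed x hx
    simp only [hRi]
    push_cast
    exact h
  -- (d) signs in the free abelian group
  have key : ∀ k : Fin (d + 1),
      (∑ s : Fin 2, ((-1 : ℤ) ^ ((k : ℕ) + (s : ℕ))) • KZ.of (rf k s)) =
        ((-1 : ℤ) ^ (k : ℕ)) • ((KZ.of (Rt k) - KZ.of (rf k 1) + KZ.of (rf k 0)) +
          (KZ.of (R k) - KZ.of (Rt k))) - ((-1 : ℤ) ^ (k : ℕ)) • KZ.of (R k) := by
    intro k
    rw [Fin.sum_univ_two]
    simp only [Fin.val_zero, Fin.val_one]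
    module
  rw [Finset.sum_congr rfl fun k _ => key k, Finset.sum_sub_distrib]
  exact KZ.relations.sub_mem
    (KZ.relations.sum_mem fun k _ => KZ.relations.zsmul_mem (KZ.relations.add_mem (h1 k) (h2 k)) _) h3

end CubeStokesSplit

/-! ## `CubeStokes` -/

/-- **Settles stmt-KontsevichZagierPeriods-5566 (`CubeStokes`)**: closed-form Stokes on the unit cube
is a relation of the Kontsevich–Zagier calculus — the assembly `CubeStokesSplit.cubeStokes_of_subs`
fed with the three proved pieces. [cite: KontsevichZagier2001, §1.2] -/
theorem cubeStokes_proof : CubeStokes :=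
  CubeStokesSplit.cubeStokes_of_subs CubeLastNewtonLeibniz.cubeLastNewtonLeibniz_proof
    CubeCoordinateCycle.cubeCoordinateCycle_proof ZeroCombination.zeroCombination_proof

end Summit.KontsevichZagierPeriods.CobordismMove
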